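import Literature.MathematicalPhysics.QuantumFieldTheory.Balaban1983to89.B9SectBE4H2GReadWriteY
import Literature.MathematicalPhysics.QuantumFieldTheory.Balaban1983to89.B9SectBE4H2GFrameV6
import Literature.MathematicalPhysics.QuantumFieldTheory.Balaban1983to89.B9SectBH1GFrameCodedY

/-!
# `Balaban1983to89.B9SectBE4H2GFrameCodedY` — ★★ THE (3.44) ∕ (3.45) TRANSFER FIELD OF THE BOND-SECTOR FRAME PROVED AT NODE 00's LETTERS: `e4h2G_transfer_KACU`
# (the field `B9SectBE4H2GFrameV6.E4H2GFrame₆.e4h2G_transfer` for `GA := KACU G x (GAY parS parB (GpY parS)) parB C37 C38`, `Gb := GbC`), the writing functions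
# `wE4G6` ∕ `wH2G6`, ★★★ the instance `e4h2GFrame₆CodedOn` and ★★ `stepE4Pos_KACU_frame_on` ∕ `stepH2Pos_KACU_frame_on` (pub-ymgap N06 row 13: the (3.44) and
# (3.45) members of `B9SectBCodedReadingsU.SectBStepU`, G side, Route L)

T. Bałaban, *Propagators for lattice gauge theories in a background field*, Commun. Math. Phys. **99** (1985) 389–434
[`Balaban1985BackgroundPropagators`, "B9"]; [4] = T. Bałaban, *Propagators and renormalization transformations for lattice gauge
theories. II*, Commun. Math. Phys. **96** (1984) 223–250 [`Balaban1984PropagatorsII`].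

statement-level skeleton of published theorems with citation tags; proofs where landed; nothing here is a claim about the
Yang–Mills mass gap

THE PRINTED LOCI.  (3.44) ∕ (3.45) p. 398; Theorem 3.3 p. 399; Theorem 3.4 p. 400 and p. 403 l. 2–5 (the same bounds for `G(U′U)` in the letters of `U`); (3.3) p. 390,
(3.8) p. 392 with (3.5) p. 391 (`∇*_ν = −R(U(x−e_ν))⁻¹τ_{−ν}∇_ν`: the backward letter read at the neighbouring bond); (3.82)–(3.86) p. 407; [4] (2.51)–(2.52) p. 232,
(2.54) p. 233, Lemma 2.1 p. 234.

WHY THIS FILE (seat dag-n06-c gen 14; bond twin of gen 12's `B9SectBE4FrameCodedY` + `B9SectBH2FrameCodedY`).  r06's per-input member (v′) and per-probe member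
(vi′) of `thm34_G_holderInput_clause_uniform_blk`, packaged as the ONE transfer field of `E4H2GFrame₆` (V6: the (3.45) writing function sees `Bε`), are proved at
NODE 00's letters for the coded bond family `KACU`: for the output words `∇_{U,ν}G(U′U)∇*_{U,μ}(J ⊗ E)` — `D_l := conj b (cdBₗ̂ U ν)`, `D_s := conj b (cdsBₗ̂ U μ)`,
input `coord(bondFunCoords(J ⊗ E))` — §1 the triple-product bridges (`lamB_DL_GbC_DR`, `lamB_L_GbC_DR`), the coordinate tools (`abs_apply_le_norm_lamB`, the
left-letter signs `abs_apply_diffLetter_inl∕inr_mul_eq`); §2 the writing functions; §3 ★★ `e4h2G_transfer_KACU`: the sup data `N` READ from the (3.44) block at the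
base (`B9SectBE4H2GReadWriteY.norm_le_e4ReadB`; backward letters on the left through `‖∇*_νΨ(x)‖ ≦ ‖∇_νΨ(x₋−e_ν)‖`, def-Y `OpsYRead342CrossB.norm_cdsB_le_norm_cdB_unshift`,
at the cost `e^{2(d+1)δc}`), the left (3.43) premise READ from the (3.43) block (`probeL_lamB_le`), `N₂` from the (3.45) block (`probe_le_h2ReadB`); outputs WRITTEN by
`e4ReadB_le_of_forall` ∕ `h2ReadB_le_of_probes`; `‖J‖_ε ≦ ‖J‖_{β+ε}` on the bond summand (`geo9K_holder_mono_bond`).  §4 the instance and the steps.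
No displayed law beyond `B9SectBGFrameCodedY.gFrame₅CodedOn`'s binders (the (3.44)∕(3.45) transfer needs neither the transporter law nor `r_L`).
HONEST SCOPE.  Kernel bookkeeping: r06's theorems are CALLED, def-Y's letters READ and WRITTEN; nothing of [B9] asserted beyond the landed modules; COUNT-NEUTRAL; N06
NOT discharged; one finite lattice programme at fixed ε — nothing continuum, nothing about OS positivity or the mass gap.  No `sorry`, no `axiom`, no `instance`, no
`notation`.  Seat `pub-ymgap-dag-n06-c` (g14), 2026-08-29; `--supports stmt-QuantumFields-27364`.
-/

noncomputable section

namespace Literature.MathematicalPhysics.QuantumFieldTheory.Balaban1983to89.B9SectBE4H2GFrameCodedY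

open LatticeFieldCalculus (supDist)
open B9Eq39Adjoint (R R_smul R_zero R_sub R_add)
open B6GlobalChartV1 (PV blkV1 boxEquiv)
open B6Geom246MultiLevelTorus (geomT)
open B6Ineq2142KLevelV1 (β beta_level)
open B6KLevelCensusIndexV1 (KIdx Adm kGeo)
open B6RandomWalk (HasMajorant hasMajorant_mono BlockSupp Ineq261)
open B9Thm34Ext (toB6)
open B9FromB6 (EBlock H1Block E4Block H2Block)
open B9GeoNormsKLevelV1 (geo9K geo9K_dist_nonneg geo9K_holder_mono_bond)
open B9GeoLemma21KLevelV1 (geo9Y_dist_comm geo9Y_dist_triangle geo9Y_len_pos one_le_k)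
open B9Eq310Hermitian (norm_R_le)
open B9Eq352DivFormLetters (conj coordEquiv conj_neg norm_coordSymm_apply_le)
open B9Eq352GradLetters (diffLetter)
open B9Eq371GradLetters (bT bU)
open B9CoReadingCoords (cdBₗ cdsBₗ cdBₗ_apply cdsBₗ_apply)
open B9BackgroundsKLevelV1 (shiftsV1)
open B9PinMembersKLevelV1 (MemberY geo9Y bg9Y)
open B9Eq360DeltaPrimeAY (AfldY)
open B9SectBGpLettersY (GVal decY decY_base blkC coordC norm_le_one_and_inv_of_mem)
open B9SectBL2DictionaryY (coordC_base_eq)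
open B9SectBGpFrameCodedY (codingYx CplxLettersY)
open B9SectBGpReadingsY (KSC baseY)
open B9SectBCodedCarrier (CCfg pullS)
open B9SectBCodedReadingsU (KACU)
open B9SectBKerFrameCodedY (CinvY)
open B9SectBStepWhole (StepPos StepE4Pos StepH2Pos StepPos.mono)
open B9RWSumsReadsNbr (nbr mem_nbr)
open B9GeoNormsKLevelModelSignsV1 (modelSignsOn_geo9K)
open Node00 (SiteY BlkY FBondY IBondY CfgY BallY SiteParY BondParY BondOpY liftY liftY_apply holderQB cdB cdsB UboxY shiftY GAY GpY XY deltaAY deltaPrimeAY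
  bondCoordsY bondFunCoordsY)
open Node00.OpsYRead342CrossB (norm_cdsB_le_norm_cdB_unshift dist_blkV1_unshift_le)
open B9SectBGWordDeltaAY (bondOpCoordsRY GbC)
open B9SectBGReadCodedY (eta_inv_eq_abs_cf hasMajorant_of_eq hasMajorant_conj_bondOpCoordsRY GbC_eq_conj_bondOpCoordsRY bondOpCoordsRY_mul bondOpCoordsRY_cdBₗ
  bondOpCoordsRY_cdsBₗ diffLetter_abs_eq)
open B9SectBGReadY (readG342Y_KACU)
open B9SectBGFrameCodedY (gFrame₅CodedOn cXY cXY_nonneg parB_contractive)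
open B9SectBGClassLettersY (Reg335PlaqY CplxLettersGY VarParBY)
open B9SectBE4H2GFrameV6 (E4H2GFrame₆ stepE4H2Pos_of_e4h2GFrame₆)
open B9SectBH1GReadWriteY (probeB norm_probeB h1ReadB KACU_h1_inr_eq)
open B9SectBH1GProbesY (lamB lamB_apply' lamB_GbC lamB_DL_GbC lamB_GbC_DR lamB_conj_bondOpCoordsRY lamB_coordEquiv_bondFunCoordsY probeBC probeBC_symm
  blockSupp_coordEquiv_bondFun_liftY probeL_lamB_le blkC_snd_eq_blkV1 blkC_bondCoordsY_snd)
open B9SectBH1GUndiffY (HolderLipBY cutH_inr_nonneg)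
open B9SectBE4H2GReadWriteY (e4ReadB h2ReadB KACU_e4_inr_eq KACU_e4_inl KACU_h2_inr_eq KACU_h2_off norm_le_e4ReadB probe_le_h2ReadB e4ReadB_le_of_forall
  h2ReadB_le_of_probes)

variable {d ℓ : ℕ} {hd : 1 ≤ d + 1} {hL : Odd (ℓ + 1) ∧ 1 < ℓ + 1} {b₀ b₁ : ℝ} {Mstar : ℕ}
variable {𝔸 : Type} [NormedRing 𝔸] [NormedAlgebra ℂ 𝔸] [CompleteSpace 𝔸]

/-! ## §1 Triple-product bridges and coordinate tools -/

section Bridges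

variable {ι : Type} [Fintype ι] (x : MemberY d ℓ hd hL b₀ b₁ Mstar) (parS : SiteParY 𝔸 x.toKIdx) (parB : BondParY 𝔸 x.toKIdx) (b : Module.Basis ι ℝ 𝔸)

/-- ★ BRIDGE (the printed output word): `lamB ((conj b (cdBₗ̂ U ν) * GbC c * conj b (cdsBₗ̂ U μ)) v) = ∇_{U,ν}(G(dec c)(∇*_{U,μ}(lamB v)))`.
[cite: Balaban1985BackgroundPropagators, (3.44) p.398, (3.3) p.390, (3.8) p.392; Balaban1984PropagatorsII, (2.51)–(2.52) p.232] -/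
theorem lamB_DL_GbC_DR (U : CfgY 𝔸 x.toKIdx) (ν μ : Fin (d + 1)) (c : CCfg (CfgY 𝔸 x.toKIdx) (AfldY 𝔸 x.toKIdx)) (v : (Fin (d + 1) × SiteY x.toKIdx) × ι → ℝ) :
    lamB x.toKIdx b ((conj b (bondOpCoordsRY x.toKIdx (cdBₗ x.toKIdx U ν)) * GbC x.toKIdx parS parB b c *
        conj b (bondOpCoordsRY x.toKIdx (cdsBₗ x.toKIdx U μ))) v) =
      cdB x.toKIdx U ν (GAY x.toKIdx parS parB (GpY x.toKIdx parS) (decY x.toKIdx c) (cdsB x.toKIdx U μ (lamB x.toKIdx b v))) := by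
  rw [mul_assoc, Module.End.mul_apply, lamB_conj_bondOpCoordsRY, lamB_GbC_DR]; rfl

/-- BRIDGE with an arbitrary real-linear bond letter `L` on the left: `lamB ((conj b L̂ * GbC c * conj b (cdsBₗ̂ U μ)) v) = L(G(dec c)(∇*_{U,μ}(lamB v)))`.
[cite: Balaban1985BackgroundPropagators, (3.44) p.398; Balaban1984PropagatorsII, (2.51)–(2.52) p.232] -/
theorem lamB_L_GbC_DR (L : Module.End ℝ (FBondY x.toKIdx → 𝔸)) (U : CfgY 𝔸 x.toKIdx) (μ : Fin (d + 1)) (c : CCfg (CfgY 𝔸 x.toKIdx) (AfldY 𝔸 x.toKIdx))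
    (v : (Fin (d + 1) × SiteY x.toKIdx) × ι → ℝ) :
    lamB x.toKIdx b ((conj b (bondOpCoordsRY x.toKIdx L) * GbC x.toKIdx parS parB b c * conj b (bondOpCoordsRY x.toKIdx (cdsBₗ x.toKIdx U μ))) v) =
      L (GAY x.toKIdx parS parB (GpY x.toKIdx parS) (decY x.toKIdx c) (cdsB x.toKIdx U μ (lamB x.toKIdx b v))) := by
  rw [mul_assoc, Module.End.mul_apply, lamB_conj_bondOpCoordsRY, lamB_GbC_DR]

omit [CompleteSpace 𝔸] in
/-- a coordinate is at most `M₂` times the norm of the vector, read through `lamB`: `|v(p)| ≦ M₂‖(lamB v)(bond of p)‖`.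
[cite: Balaban1984PropagatorsII, (2.51) p.232, bookkeeping] -/
theorem abs_apply_le_norm_lamB {M₂ : ℝ} (hrepr : ∀ (v : 𝔸) (j : ι), |b.repr v j| ≤ M₂ * ‖v‖) (v : (Fin (d + 1) × SiteY x.toKIdx) × ι → ℝ)
    (p : (Fin (d + 1) × SiteY x.toKIdx) × ι) : |v p| ≤ M₂ * ‖lamB x.toKIdx b v ((bondCoordsY x.toKIdx).symm p.1)‖ := by
  have h : v p = b.repr ((coordEquiv b).symm v p.1) p.2 := by
    conv_lhs => rw [← (coordEquiv b).apply_symm_apply v]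
    rfl
  rw [h, lamB_apply', Equiv.apply_symm_apply]
  exact hrepr _ _

/-- the r06-syntax FORWARD letter on the LEFT, up to sign, at a coordinate of a triple product: `|((conj b (diffLetter … |c_f| (inl ν)) * X * Y) v)(z)| = |((conj b (cdBₗ̂ U ν) * X * Y) v)(z)|`.
[cite: Balaban1985BackgroundPropagators, (3.3) p.390, (3.44) p.398; Balaban1984PropagatorsII, (2.51)–(2.52) p.232] -/
theorem abs_apply_diffLetter_inl_mul_eq (X Y : Module.End ℝ ((Fin (d + 1) × SiteY x.toKIdx) × ι → ℝ)) (U : CfgY 𝔸 x.toKIdx) (ν : Fin (d + 1))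
    (v : (Fin (d + 1) × SiteY x.toKIdx) × ι → ℝ) (z : (Fin (d + 1) × SiteY x.toKIdx) × ι) :
    |((conj b (diffLetter (bT (shiftY x.toKIdx)) (bU (UboxY x.toKIdx U)) ((|x.toKIdx.cf| : ℝ) : ℂ) (Sum.inl ν)) * X * Y) v) z| =
      |((conj b (bondOpCoordsRY x.toKIdx (cdBₗ x.toKIdx U ν)) * X * Y) v) z| := by
  rcases diffLetter_abs_eq (bT (shiftY x.toKIdx)) (bU (UboxY x.toKIdx U)) x.toKIdx.cf (Sum.inl ν) with h | h
  · rw [h, bondOpCoordsRY_cdBₗ]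
  · rw [h, bondOpCoordsRY_cdBₗ, conj_neg]
    simp only [Module.End.mul_apply, LinearMap.neg_apply, Pi.neg_apply, abs_neg]

/-- the r06-syntax BACKWARD letter on the LEFT, up to sign, at a coordinate of a triple product: `|((conj b (diffLetter … |c_f| (inr ν)) * X * Y) v)(z)| = |((conj b (cdsBₗ̂ U ν) * X * Y) v)(z)|`.
[cite: Balaban1985BackgroundPropagators, (3.8) p.392, (3.44) p.398; Balaban1984PropagatorsII, (2.51)–(2.52) p.232] -/
theorem abs_apply_diffLetter_inr_mul_eq (X Y : Module.End ℝ ((Fin (d + 1) × SiteY x.toKIdx) × ι → ℝ)) (U : CfgY 𝔸 x.toKIdx) (ν : Fin (d + 1))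
    (v : (Fin (d + 1) × SiteY x.toKIdx) × ι → ℝ) (z : (Fin (d + 1) × SiteY x.toKIdx) × ι) :
    |((conj b (diffLetter (bT (shiftY x.toKIdx)) (bU (UboxY x.toKIdx U)) ((|x.toKIdx.cf| : ℝ) : ℂ) (Sum.inr ν)) * X * Y) v) z| =
      |((conj b (bondOpCoordsRY x.toKIdx (cdsBₗ x.toKIdx U ν)) * X * Y) v) z| := by
  rcases diffLetter_abs_eq (bT (shiftY x.toKIdx)) (bU (UboxY x.toKIdx U)) x.toKIdx.cf (Sum.inr ν) with h | h
  · rw [h, bondOpCoordsRY_cdsBₗ, conj_neg]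
    simp only [Module.End.mul_apply, LinearMap.neg_apply, Pi.neg_apply, abs_neg]
  · rw [h, bondOpCoordsRY_cdsBₗ]

end Bridges

/-! ## §2 The output writing functions -/

/-- the (3.44) writing function: `wE4G6 dd Sb M₂ B δc Bε ε = Σ‖b_j‖·B·M₂·(B⁺_ε·e^{2(d+1)δc} + 1)` (gen 12's `wE4₆`, bond sector).
[cite: Balaban1985BackgroundPropagators, (3.44) p.398, p.403 l.2–5 («of course with different constants»)] -/
def wE4G6 (dd Sb M₂ : ℝ) (B δc : ℝ) (Bε : ℝ → ℝ) : ℝ → ℝ := fun ε => Sb * B * M₂ * (max (Bε ε) 0 * Real.exp (δc * dd) + 1)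

/-- the (3.45) writing function: `wH2G6 dd Sb M₂ B δc Bβ Bε Bεβ ε β = B·(B⁺_{εβ} + Σ‖b_j‖·B⁺_β·M₂·(B⁺_ε·e^{2(d+1)δc} + 1))`.
[cite: Balaban1985BackgroundPropagators, (3.45) p.398, p.403 l.2–5 («of course with different constants»)] -/
def wH2G6 (dd Sb M₂ : ℝ) (B δc : ℝ) (Bβ Bε : ℝ → ℝ) (Bεβ : ℝ → ℝ → ℝ) : ℝ → ℝ → ℝ := fun ε β' =>
  B * (max (Bεβ ε β') 0 + Sb * max (Bβ β') 0 * M₂ * (max (Bε ε) 0 * Real.exp (δc * dd) + 1))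

omit [NormedAlgebra ℂ 𝔸] [CompleteSpace 𝔸] [NormedRing 𝔸] in
/-- `0 ≤ wE4G6`. [cite: Balaban1985BackgroundPropagators, (3.44) p.398, bookkeeping] -/
theorem wE4G6_nonneg {dd Sb M₂ B δc : ℝ} (Bε : ℝ → ℝ) (hSb : 0 ≤ Sb) (hB : 0 ≤ B) (hM₂ : 0 ≤ M₂) (ε : ℝ) : 0 ≤ wE4G6 dd Sb M₂ B δc Bε ε := by
  unfold wE4G6
  have h0 : 0 ≤ max (Bε ε) 0 := le_max_right _ _
  positivity

omit [NormedAlgebra ℂ 𝔸] [CompleteSpace 𝔸] [NormedRing 𝔸] in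
/-- `0 ≤ wH2G6`. [cite: Balaban1985BackgroundPropagators, (3.45) p.398, bookkeeping] -/
theorem wH2G6_nonneg {dd Sb M₂ B δc : ℝ} (Bβ Bε : ℝ → ℝ) (Bεβ : ℝ → ℝ → ℝ) (hSb : 0 ≤ Sb) (hB : 0 ≤ B) (hM₂ : 0 ≤ M₂) (ε β' : ℝ) :
    0 ≤ wH2G6 dd Sb M₂ B δc Bβ Bε Bεβ ε β' := by
  unfold wH2G6
  have h0 : 0 ≤ max (Bε ε) 0 := le_max_right _ _
  have h1 : 0 ≤ max (Bβ β') 0 := le_max_right _ _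
  have h2 : 0 ≤ max (Bεβ ε β') 0 := le_max_right _ _
  positivity

/-! ## §3 ★★ The (3.44) ∕ (3.45) transfer field PROVED at def-Y's bond letters for `KACU` -/

section Transfer

variable [NormOneClass 𝔸] (c35 : ℝ) (G : Subgroup 𝔸ˣ) (x : MemberY d ℓ hd hL b₀ b₁ Mstar) (par : SiteParY 𝔸 x.toKIdx) (parB : BondParY 𝔸 x.toKIdx)
  {ι : Type} [Fintype ι] (b : Module.Basis ι ℝ 𝔸) (ιB : BlkY x.toKIdx → IBondY x.toKIdx) [Fintype (geo9Y x).Site]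
  (C37 C38 : ℝ → CfgY 𝔸 x.toKIdx → AfldY 𝔸 x.toKIdx → Prop)

set_option maxHeartbeats 1600000 in
/-- ★★ **THE (3.44) ∕ (3.45) TRANSFER FIELD OF THE BOND-SECTOR FRAME, PROVED FOR `KACU` AT def-Y's LETTERS**: from r06's per-input member (v′) (`HV`) and per-probe
member (vi′) (`HVI`) for the letter `GbC` of the member (the shapes of `E4H2GFrame₆.e4h2G_transfer`), the (3.42) and (3.43)–(3.45) blocks of `KACU` at the base and
unit norms of the bond variables (`G`-valued base), the (3.44) AND (3.45) blocks of `KACU` at the coded product with `(wE4G6 … B δc Bε, δc∕7)` and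
`(wH2G6 … B δc Bβ Bε Bεβ, δc∕7)`. [cite: Balaban1985BackgroundPropagators, Thm 3.4 p.400, Thm 3.3 p.399, (3.44)–(3.45) p.398, (3.40) p.397, p.403 l.2–5, (3.82)–(3.86) p.407; Balaban1984PropagatorsII, (2.51)–(2.52) p.232, (2.54) p.233, Lemma 2.1 p.234] -/
theorem e4h2G_transfer_KACU (hι : ∀ s : BlkY x.toKIdx, β x.toKIdx.hN x.toKIdx.D x.toKIdx.hk (ιB s) = s)
    (hG1 : ∀ u : 𝔸ˣ, u ∈ G → ‖(u : 𝔸)‖ ≤ 1)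
    {M₂ : ℝ} (hM₂ : 0 ≤ M₂) (hrepr : ∀ (v : 𝔸) (j : ι), |b.repr v j| ≤ M₂ * ‖v‖)
    {MInv : ℝ} (cRG : ℝ → ℝ) {aInv aW : ℝ}
    (α₀ : ℝ) (c c' : (codingYx G x C37 C38).bg.Cfg) (α₁ B₀ B δ δc : ℝ) (Bβ Bε : ℝ → ℝ) (Bεβ : ℝ → ℝ → ℝ)
    (_hM : MInv ≤ (geo9Y x).M) (_hα₀ : 0 < α₀) (_hMa : (geo9Y x).M * α₀ ≤ aInv) (hreg : (codingYx G x C37 C38).bg.Reg335 c35 α₀ c)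
    (_hα₁ : 0 < α₁) (_haW : α₁ ≤ aW) (h37 : (codingYx G x C37 C38).bg.Cplx337 α₁ c c') (hB₀ : 0 < B₀) (hB : 0 ≤ B)
    (_hδ : 0 < δ) (hδc : 0 < δc) (hδcδ : δc ≤ δ) (hcRG : M₂ * (∑ j, ‖b j‖) ≤ cRG δ)
    (hE : EBlock (KACU G x (GAY x.toKIdx par parB (GpY x.toKIdx par)) parB C37 C38) B₀ δ c)
    (hHH : B9.Ineq343_345 (KACU G x (GAY x.toKIdx par parB (GpY x.toKIdx par)) parB C37 C38) Bβ Bε Bεβ δ c)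
    (HV : ∀ (Dl Ds : Module.End ℝ ((Fin (d + 1) × SiteY x.toKIdx) × ι → ℝ)),
      HasMajorant (g := toB6 (geo9Y x) (0 : ℝ) True) (fun q : (Fin (d + 1) × SiteY x.toKIdx) × ι => blkC x.toKIdx ιB q.1.2) (Dl * GbC x.toKIdx par parB b c)
        (fun a a' => cRG δ * B₀ * (geo9Y x).len a * Real.exp (-(δc * (geo9Y x).dist a a'))) →
      HasMajorant (g := toB6 (geo9Y x) (0 : ℝ) True) (fun q : (Fin (d + 1) × SiteY x.toKIdx) × ι => blkC x.toKIdx ιB q.1.2) (GbC x.toKIdx par parB b c * Ds)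
        (fun a a' => cRG δ * B₀ * (geo9Y x).len a * Real.exp (-(δc * (geo9Y x).dist a a'))) →
      ∀ (y' : IBondY x.toKIdx) (μ : (Fin (d + 1) × SiteY x.toKIdx) × ι → ℝ) (M : ℝ),
        BlockSupp (g := toB6 (geo9Y x) (0 : ℝ) True) (fun q : (Fin (d + 1) × SiteY x.toKIdx) × ι => blkC x.toKIdx ιB q.1.2) μ y' M →
      ∀ (N : ℝ), 0 ≤ N →
        (∀ (k : Fin (d + 1) ⊕ Fin (d + 1)) (z : (Fin (d + 1) × SiteY x.toKIdx) × ι),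
          |(((conj b (diffLetter (bT (shiftY x.toKIdx)) (bU (coordC G x.toKIdx c)) ((((geo9Y x).eta : ℂ))⁻¹) k)) * GbC x.toKIdx par parB b c * Ds) μ) z| ≤
            N * Real.exp (-(δc * (geo9Y x).dist (blkC x.toKIdx ιB z.1.2) y'))) →
        (∀ z : (Fin (d + 1) × SiteY x.toKIdx) × ι, |((Dl * GbC x.toKIdx par parB b c * Ds) μ) z| ≤ N * Real.exp (-(δc * (geo9Y x).dist (blkC x.toKIdx ιB z.1.2) y'))) →
        ∀ p : (Fin (d + 1) × SiteY x.toKIdx) × ι, |((Dl * GbC x.toKIdx par parB b ((codingYx G x C37 C38).bg.mul c' c) * Ds) μ) p| ≤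
          B * (N + M) * Real.exp (-(δc / 7 * (geo9Y x).dist (blkC x.toKIdx ιB p.1.2) y')))
    (HVI : ∀ (Dl Ds : Module.End ℝ ((Fin (d + 1) × SiteY x.toKIdx) × ι → ℝ)),
      HasMajorant (g := toB6 (geo9Y x) (0 : ℝ) True) (fun q : (Fin (d + 1) × SiteY x.toKIdx) × ι => blkC x.toKIdx ιB q.1.2) (Dl * GbC x.toKIdx par parB b c)
        (fun a a' => cRG δ * B₀ * (geo9Y x).len a * Real.exp (-(δc * (geo9Y x).dist a a'))) →
      HasMajorant (g := toB6 (geo9Y x) (0 : ℝ) True) (fun q : (Fin (d + 1) × SiteY x.toKIdx) × ι => blkC x.toKIdx ιB q.1.2) (GbC x.toKIdx par parB b c * Ds)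
        (fun a a' => cRG δ * B₀ * (geo9Y x).len a * Real.exp (-(δc * (geo9Y x).dist a a'))) →
      ∀ (Φ : (Fin (d + 1) × SiteY x.toKIdx → 𝔸) →ₗ[ℝ] 𝔸) (y : IBondY x.toKIdx) (p₀ : (Fin (d + 1) × SiteY x.toKIdx) × ι), blkC x.toKIdx ιB p₀.1.2 = y →
      ∀ (γ Bh cζ : ℝ), 0 ≤ Bh → 0 ≤ cζ →
        (∀ (y'' : IBondY x.toKIdx) (ν : (Fin (d + 1) × SiteY x.toKIdx) × ι → ℝ) (C : ℝ),
          BlockSupp (g := toB6 (geo9Y x) (0 : ℝ) True) (fun q : (Fin (d + 1) × SiteY x.toKIdx) × ι => blkC x.toKIdx ιB q.1.2) ν y'' C →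
          ‖Φ ((coordEquiv b).symm (Dl (GbC x.toKIdx par parB b c ν)))‖ ≤ Bh * (geo9Y x).len y ^ (1 - γ) * cζ * Real.exp (-(δc * (geo9Y x).dist y y'')) * C) →
      ∀ (y' : IBondY x.toKIdx) (μ : (Fin (d + 1) × SiteY x.toKIdx) × ι → ℝ) (M : ℝ),
        BlockSupp (g := toB6 (geo9Y x) (0 : ℝ) True) (fun q : (Fin (d + 1) × SiteY x.toKIdx) × ι => blkC x.toKIdx ιB q.1.2) μ y' M →
      ∀ (N : ℝ), 0 ≤ N →
        (∀ (k : Fin (d + 1) ⊕ Fin (d + 1)) (z : (Fin (d + 1) × SiteY x.toKIdx) × ι),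
          |(((conj b (diffLetter (bT (shiftY x.toKIdx)) (bU (coordC G x.toKIdx c)) ((((geo9Y x).eta : ℂ))⁻¹) k)) * GbC x.toKIdx par parB b c * Ds) μ) z| ≤
            N * Real.exp (-(δc * (geo9Y x).dist (blkC x.toKIdx ιB z.1.2) y'))) →
      ∀ (N₂ : ℝ), 0 ≤ N₂ → ‖Φ ((coordEquiv b).symm ((Dl * GbC x.toKIdx par parB b c * Ds) μ))‖ ≤ N₂ * Real.exp (-(δc * (geo9Y x).dist y y')) →
        ‖Φ ((coordEquiv b).symm ((Dl * GbC x.toKIdx par parB b ((codingYx G x C37 C38).bg.mul c' c) * Ds) μ))‖ ≤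
          B * (N₂ + Bh * (geo9Y x).len y ^ (1 - γ) * cζ * ((geo9Y x).len y)⁻¹ * (N + M)) * Real.exp (-(δc / 7 * (geo9Y x).dist y y'))) :
    E4Block (KACU G x (GAY x.toKIdx par parB (GpY x.toKIdx par)) parB C37 C38) (wE4G6 (2 * ((d : ℝ) + 1)) (∑ j, ‖b j‖) M₂ B δc Bε) (δc / 7)
        ((codingYx G x C37 C38).bg.mul c' c) ∧
      H2Block (KACU G x (GAY x.toKIdx par parB (GpY x.toKIdx par)) parB C37 C38) (wH2G6 (2 * ((d : ℝ) + 1)) (∑ j, ‖b j‖) M₂ B δc Bβ Bε Bεβ) (δc / 7)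
        ((codingYx G x C37 C38).bg.mul c' c) := by
  classical
  letI : Fintype (B9GeoNormsKLevelV1.geo9K x.toKIdx).Site := ‹Fintype (geo9Y x).Site›
  -- the coded pair is (base U, mult a); the product is `prod U a`
  obtain ⟨U, a, rfl, rfl, hCa⟩ := (codingYx G x C37 C38).exists_of_bg_Cplx337 h37
  have hU335 : (bg9Y 𝔸 G x).Reg335 c35 α₀ U := by
    obtain ⟨U', h1, h2⟩ := (codingYx G x C37 C38).exists_of_bg_Reg335 hreg
    cases h1
    exact h2
  have hU : GVal G x.toKIdx U := hU335.1.1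
  -- notation and elementary facts
  set Sb : ℝ := ∑ j, ‖b j‖ with hSb
  have hSb0 : 0 ≤ Sb := Finset.sum_nonneg fun j _ => norm_nonneg _
  set OA : BondOpY 𝔸 x.toKIdx := GAY x.toKIdx par parB (GpY x.toKIdx par) with hOA
  set TU : (FBondY x.toKIdx → 𝔸) →ₗ[ℂ] (FBondY x.toKIdx → 𝔸) := OA U with hTU
  set TW : (FBondY x.toKIdx → 𝔸) →ₗ[ℂ] (FBondY x.toKIdx → 𝔸) := OA (decY x.toKIdx (.prod U a)) with hTW
  have hco : coordC G x.toKIdx (.base U) = UboxY x.toKIdx U := coordC_base_eq G x hU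
  have hη : ((((geo9Y x).eta : ℂ)))⁻¹ = ((|x.toKIdx.cf| : ℝ) : ℂ) := eta_inv_eq_abs_cf x.toKIdx
  have hDk : ∀ k : Fin (d + 1) ⊕ Fin (d + 1),
      diffLetter (bT (shiftY x.toKIdx)) (bU (coordC G x.toKIdx (.base U))) ((((geo9Y x).eta : ℂ))⁻¹) k =
        diffLetter (bT (shiftY x.toKIdx)) (bU (UboxY x.toKIdx U)) ((|x.toKIdx.cf| : ℝ) : ℂ) k := by
    intro k; rw [hco, hη]
  have hUu : ∀ (ν : Fin (d + 1)) (s : Site (PV d ℓ x.m x.K hd hL) 0),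
      ‖((U ν s : 𝔸ˣ) : 𝔸)‖ ≤ 1 ∧ ‖(((U ν s)⁻¹ : 𝔸ˣ) : 𝔸)‖ ≤ 1 := fun ν s => norm_le_one_and_inv_of_mem G hG1 (hU ν s)
  have hdd : 0 ≤ 2 * ((d : ℝ) + 1) := by positivity
  have hdn : ∀ a a' : IBondY x.toKIdx, 0 ≤ (geo9Y x).dist a a' := fun a a' => geo9K_dist_nonneg x.toKIdx a a'
  have hk1 : 1 ≤ x.toKIdx.k := one_le_k x.toKIdx
  -- the input blocks at the base
  have hEU : EBlock (KACU G x OA parB C37 C38) B₀ δ (.base U) := hE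
  have hH1U : H1Block (KACU G x OA parB C37 C38) Bβ δ (.base U) := hHH.1
  have hE4U : E4Block (KACU G x OA parB C37 C38) Bε δ (.base U) := hHH.2.1
  have hH2U : H2Block (KACU G x OA parB C37 C38) Bεβ δ (.base U) := hHH.2.2
  -- the (3.42) majorants of `∇_{U,ν}G(U)` and `G(U)∇*_{U,μ}` at the base, transported to r06's carrier, lowered to δc, constant raised to `cRG δ`
  have cR0 : 0 ≤ M₂ * Sb := mul_nonneg hM₂ hSb0
  obtain ⟨-, g1, g2, -⟩ := readG342Y_KACU (Rr := 0) (Hp := True) b G x OA parB C37 C38 ιB hι hM₂ hrepr hB₀.le hEU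
  have hGbU : GbC x.toKIdx par parB b (.base U) = conj b (bondOpCoordsRY x.toKIdx (TU.restrictScalars ℝ)) := by
    rw [GbC_eq_conj_bondOpCoordsRY, decY_base]
  have raise : ∀ {T : Module.End ℝ ((Fin (d + 1) × SiteY x.toKIdx) × ι → ℝ)},
      HasMajorant (g := toB6 (geo9Y x) (0 : ℝ) True) (fun q : (Fin (d + 1) × SiteY x.toKIdx) × ι => blkC x.toKIdx ιB q.1.2) T
        (fun a a' => M₂ * Sb * (B₀ * (geo9Y x).len a * Real.exp (-(δ * (geo9Y x).dist a a')))) →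
      HasMajorant (g := toB6 (geo9Y x) (0 : ℝ) True) (fun q : (Fin (d + 1) × SiteY x.toKIdx) × ι => blkC x.toKIdx ιB q.1.2) T
        (fun a a' => cRG δ * B₀ * (geo9Y x).len a * Real.exp (-(δc * (geo9Y x).dist a a'))) := by
    intro T h
    refine hasMajorant_mono _ h fun a a' => ?_
    have hexp : Real.exp (-(δ * (geo9Y x).dist a a')) ≤ Real.exp (-(δc * (geo9Y x).dist a a')) := Real.exp_le_exp.2 (by nlinarith [hdn a a'])
    have hfac : 0 ≤ B₀ * (geo9Y x).len a := mul_nonneg hB₀.le (geo9Y_len_pos x a).le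
    calc M₂ * Sb * (B₀ * (geo9Y x).len a * Real.exp (-(δ * (geo9Y x).dist a a')))
        ≤ M₂ * Sb * (B₀ * (geo9Y x).len a * Real.exp (-(δc * (geo9Y x).dist a a'))) :=
          mul_le_mul_of_nonneg_left (mul_le_mul_of_nonneg_left hexp hfac) cR0
      _ ≤ cRG δ * (B₀ * (geo9Y x).len a * Real.exp (-(δc * (geo9Y x).dist a a'))) :=
          mul_le_mul_of_nonneg_right hcRG (mul_nonneg hfac (Real.exp_pos _).le)
      _ = _ := by ring
  have hmajL : ∀ ν : Fin (d + 1), HasMajorant (g := toB6 (geo9Y x) (0 : ℝ) True) (fun q : (Fin (d + 1) × SiteY x.toKIdx) × ι => blkC x.toKIdx ιB q.1.2)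
      (conj b (bondOpCoordsRY x.toKIdx (cdBₗ x.toKIdx U ν)) * GbC x.toKIdx par parB b (.base U))
      (fun a a' => cRG δ * B₀ * (geo9Y x).len a * Real.exp (-(δc * (geo9Y x).dist a a'))) := by
    intro ν
    have heq : conj b (bondOpCoordsRY x.toKIdx (cdBₗ x.toKIdx U ν ∘ₗ TU.restrictScalars ℝ)) =
        conj b (bondOpCoordsRY x.toKIdx (cdBₗ x.toKIdx U ν)) * GbC x.toKIdx par parB b (.base U) := by
      rw [hGbU, ← B9Eq352DivFormLetters.conj_mul, ← bondOpCoordsRY_mul]; rfl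
    exact raise (hasMajorant_of_eq x.toKIdx heq.symm (hasMajorant_conj_bondOpCoordsRY x.toKIdx b ιB _ (g1 ν)))
  have hmajR : ∀ μ : Fin (d + 1), HasMajorant (g := toB6 (geo9Y x) (0 : ℝ) True) (fun q : (Fin (d + 1) × SiteY x.toKIdx) × ι => blkC x.toKIdx ιB q.1.2)
      (GbC x.toKIdx par parB b (.base U) * conj b (bondOpCoordsRY x.toKIdx (cdsBₗ x.toKIdx U μ)))
      (fun a a' => cRG δ * B₀ * (geo9Y x).len a * Real.exp (-(δc * (geo9Y x).dist a a'))) := by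
    intro μ
    have heq : conj b (bondOpCoordsRY x.toKIdx (TU.restrictScalars ℝ ∘ₗ cdsBₗ x.toKIdx U μ)) =
        GbC x.toKIdx par parB b (.base U) * conj b (bondOpCoordsRY x.toKIdx (cdsBₗ x.toKIdx U μ)) := by
      rw [hGbU, ← B9Eq352DivFormLetters.conj_mul, ← bondOpCoordsRY_mul]; rfl
    exact raise (hasMajorant_of_eq x.toKIdx heq.symm (hasMajorant_conj_bondOpCoordsRY x.toKIdx b ιB _ (g2 μ)))
  ------------------------------------------------------------------
  -- the (3.44) data at the base for an amplitude `J ⊗ E` supported in the block of `y′`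
  ------------------------------------------------------------------
  have e4data : ∀ (ε : ℝ), 0 < ε → ε ≤ 1 → ∀ (J : FBondY x.toKIdx → ℝ) (y' : IBondY x.toKIdx), (geo9Y x).suppIn (Sum.inr J) y' →
      ∀ (E : BallY 𝔸) (ν μ : Fin (d + 1)) (q : FBondY x.toKIdx),
      ‖cdB x.toKIdx U ν (TU (cdsB x.toKIdx U μ (liftY J (E : 𝔸)))) q‖ ≤
          max (Bε ε) 0 * Real.exp (-(δc * (geo9Y x).dist (ιB (blkV1 x.toKIdx.hN x.toKIdx.D q)) y')) *
            ((geo9Y x).holder ε (Sum.inr J) + (geo9Y x).supNorm (Sum.inr J)) ∧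
        ‖cdsB x.toKIdx U ν (TU (cdsB x.toKIdx U μ (liftY J (E : 𝔸)))) q‖ ≤
          max (Bε ε) 0 * Real.exp (δc * (2 * ((d : ℝ) + 1))) * Real.exp (-(δc * (geo9Y x).dist (ιB (blkV1 x.toKIdx.hN x.toKIdx.D q)) y')) *
            ((geo9Y x).holder ε (Sum.inr J) + (geo9Y x).supNorm (Sum.inr J)) := by
    intro ε hε0 hε1 J y' hs E ν μ q₀
    have hhol : 0 ≤ (geo9Y x).holder ε (Sum.inr J) := (modelSignsOn_geo9K x.toKIdx).holder_nonneg ε _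
    have hsupN : 0 ≤ (geo9Y x).supNorm (Sum.inr J) := (modelSignsOn_geo9K x.toKIdx).supNorm_nonneg _
    have hHS : 0 ≤ (geo9Y x).holder ε (Sum.inr J) + (geo9Y x).supNorm (Sum.inr J) := add_nonneg hhol hsupN
    set Bp : ℝ := max (Bε ε) 0 with hBp
    have hBp0 : 0 ≤ Bp := le_max_right _ _
    -- the printed entry at any bond
    have forward : ∀ q : FBondY x.toKIdx, ‖cdB x.toKIdx U ν (TU (cdsB x.toKIdx U μ (liftY J (E : 𝔸)))) q‖ ≤
        Bp * Real.exp (-(δc * (geo9Y x).dist (ιB (blkV1 x.toKIdx.hN x.toKIdx.D q)) y')) * ((geo9Y x).holder ε (Sum.inr J) + (geo9Y x).supNorm (Sum.inr J)) := by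
      intro q
      have h := hE4U ε (Sum.inr J) (ιB (blkV1 x.toKIdx.hN x.toKIdx.D q)) y' hε0 hε1 hs
      rw [KACU_e4_inr_eq] at h
      have hr := norm_le_e4ReadB x.toKIdx b TU U hM₂ hrepr J (β x.toKIdx.hN x.toKIdx.D x.toKIdx.hk (ιB (blkV1 x.toKIdx.hN x.toKIdx.D q))) E ν μ
        (q := q) (by rw [hι])
      refine (hr.trans h).trans (mul_le_mul_of_nonneg_right ?_ hHS)
      have hexp : Real.exp (-(δ * (geo9Y x).dist (ιB (blkV1 x.toKIdx.hN x.toKIdx.D q)) y')) ≤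
          Real.exp (-(δc * (geo9Y x).dist (ιB (blkV1 x.toKIdx.hN x.toKIdx.D q)) y')) := Real.exp_le_exp.2 (by nlinarith [hdn (ιB (blkV1 x.toKIdx.hN x.toKIdx.D q)) y'])
      exact mul_le_mul (le_max_left _ _) hexp (Real.exp_pos _).le hBp0
    refine ⟨forward q₀, ?_⟩
    -- the backward letter on the left: the exact neighbour identity at the cost `e^{2(d+1)δc}`
    refine (norm_cdsB_le_norm_cdB_unshift x.toKIdx U hUu ν _ q₀).trans ((forward _).trans ?_)
    refine mul_le_mul_of_nonneg_right ?_ hHS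
    rw [mul_assoc]
    refine mul_le_mul_of_nonneg_left ?_ hBp0
    rw [← Real.exp_add]
    refine Real.exp_le_exp.2 ?_
    have hst := dist_blkV1_unshift_le x.toKIdx ιB hι ν q₀
    have htri := geo9Y_dist_triangle x (ιB (blkV1 x.toKIdx.hN x.toKIdx.D q₀))
      (ιB (blkV1 x.toKIdx.hN x.toKIdx.D ⟨(shiftsV1 (PV d ℓ x.m x.K hd hL) ν).symm q₀.src, q₀.dir⟩)) y'
    have hst' : (geo9Y x).dist (ιB (blkV1 x.toKIdx.hN x.toKIdx.D q₀))
        (ιB (blkV1 x.toKIdx.hN x.toKIdx.D ⟨(shiftsV1 (PV d ℓ x.m x.K hd hL) ν).symm q₀.src, q₀.dir⟩)) ≤ 2 * ((d : ℝ) + 1) := hst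
    nlinarith [hdn (ιB (blkV1 x.toKIdx.hN x.toKIdx.D ⟨(shiftsV1 (PV d ℓ x.m x.K hd hL) ν).symm q₀.src, q₀.dir⟩)) y']
  -- the sup data `N` of `∇♯_k·G(U)·D_s μ` for every letter on the left, at the coordinates of an amplitude
  have Ndata : ∀ (ε : ℝ), 0 < ε → ε ≤ 1 → ∀ (J : FBondY x.toKIdx → ℝ) (y' : IBondY x.toKIdx), (geo9Y x).suppIn (Sum.inr J) y' →
      ∀ (E : BallY 𝔸) (μ : Fin (d + 1)) (k : Fin (d + 1) ⊕ Fin (d + 1)) (z : (Fin (d + 1) × SiteY x.toKIdx) × ι),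
      |(((conj b (diffLetter (bT (shiftY x.toKIdx)) (bU (coordC G x.toKIdx (.base U))) ((((geo9Y x).eta : ℂ))⁻¹) k)) * GbC x.toKIdx par parB b (.base U) *
          conj b (bondOpCoordsRY x.toKIdx (cdsBₗ x.toKIdx U μ))) (coordEquiv b (bondFunCoordsY x.toKIdx (liftY J (E : 𝔸))))) z| ≤
        (M₂ * (max (Bε ε) 0 * Real.exp (δc * (2 * ((d : ℝ) + 1))) * ((geo9Y x).holder ε (Sum.inr J) + (geo9Y x).supNorm (Sum.inr J)))) *
          Real.exp (-(δc * (geo9Y x).dist (blkC x.toKIdx ιB z.1.2) y')) := by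
    intro ε hε0 hε1 J y' hs E μ k z
    have hhol : 0 ≤ (geo9Y x).holder ε (Sum.inr J) := (modelSignsOn_geo9K x.toKIdx).holder_nonneg ε _
    have hsupN : 0 ≤ (geo9Y x).supNorm (Sum.inr J) := (modelSignsOn_geo9K x.toKIdx).supNorm_nonneg _
    have hHS : 0 ≤ (geo9Y x).holder ε (Sum.inr J) + (geo9Y x).supNorm (Sum.inr J) := add_nonneg hhol hsupN
    have hBp0 : 0 ≤ max (Bε ε) 0 := le_max_right _ _
    set qz : FBondY x.toKIdx := (bondCoordsY x.toKIdx).symm z.1 with hqz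
    have hblk : blkC x.toKIdx ιB z.1.2 = ιB (blkV1 x.toKIdx.hN x.toKIdx.D qz) := blkC_snd_eq_blkV1 x.toKIdx ιB z
    rw [hDk, hblk]
    rcases k with ν' | ν'
    · rw [abs_apply_diffLetter_inl_mul_eq]
      refine (abs_apply_le_norm_lamB x b hrepr _ z).trans ?_
      rw [lamB_L_GbC_DR, decY_base, lamB_coordEquiv_bondFunCoordsY, cdBₗ_apply]
      refine (mul_le_mul_of_nonneg_left ((e4data ε hε0 hε1 J y' hs E ν' μ qz).1) hM₂).trans ?_
      have hone : (1 : ℝ) ≤ Real.exp (δc * (2 * ((d : ℝ) + 1))) := Real.one_le_exp (by positivity)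
      have he0 := (Real.exp_pos (-(δc * (geo9Y x).dist (ιB (blkV1 x.toKIdx.hN x.toKIdx.D qz)) y'))).le
      calc M₂ * (max (Bε ε) 0 * Real.exp (-(δc * (geo9Y x).dist (ιB (blkV1 x.toKIdx.hN x.toKIdx.D qz)) y')) *
            ((geo9Y x).holder ε (Sum.inr J) + (geo9Y x).supNorm (Sum.inr J)))
          = (M₂ * (max (Bε ε) 0 * 1 * ((geo9Y x).holder ε (Sum.inr J) + (geo9Y x).supNorm (Sum.inr J)))) *
              Real.exp (-(δc * (geo9Y x).dist (ιB (blkV1 x.toKIdx.hN x.toKIdx.D qz)) y')) := by ring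
        _ ≤ (M₂ * (max (Bε ε) 0 * Real.exp (δc * (2 * ((d : ℝ) + 1))) * ((geo9Y x).holder ε (Sum.inr J) + (geo9Y x).supNorm (Sum.inr J)))) *
              Real.exp (-(δc * (geo9Y x).dist (ιB (blkV1 x.toKIdx.hN x.toKIdx.D qz)) y')) := by
            refine mul_le_mul_of_nonneg_right (mul_le_mul_of_nonneg_left ?_ hM₂) he0
            exact mul_le_mul_of_nonneg_right (mul_le_mul_of_nonneg_left hone hBp0) hHS
    · rw [abs_apply_diffLetter_inr_mul_eq]
      refine (abs_apply_le_norm_lamB x b hrepr _ z).trans ?_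
      rw [lamB_L_GbC_DR, decY_base, lamB_coordEquiv_bondFunCoordsY, cdsBₗ_apply]
      refine (mul_le_mul_of_nonneg_left ((e4data ε hε0 hε1 J y' hs E ν' μ qz).2) hM₂).trans (le_of_eq ?_)
      ring
  refine ⟨?_, ?_⟩
  ------------------------------------------------------------------
  -- (3.44) at the product
  ------------------------------------------------------------------
  · intro ε lam y y' hε0 hε1 hlam
    have hW : 0 ≤ wE4G6 (2 * ((d : ℝ) + 1)) Sb M₂ B δc Bε ε := wE4G6_nonneg Bε hSb0 hB hM₂ ε
    have hHS : 0 ≤ (geo9Y x).holder ε lam + (geo9Y x).supNorm lam :=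
      add_nonneg ((modelSignsOn_geo9K x.toKIdx).holder_nonneg ε lam) ((modelSignsOn_geo9K x.toKIdx).supNorm_nonneg lam)
    have hRHS : 0 ≤ wE4G6 (2 * ((d : ℝ) + 1)) Sb M₂ B δc Bε ε * Real.exp (-(δc / 7 * (geo9Y x).dist y y')) *
        ((geo9Y x).holder ε lam + (geo9Y x).supNorm lam) := mul_nonneg (mul_nonneg hW (Real.exp_pos _).le) hHS
    rcases lam with f | J
    · rw [KACU_e4_inl]; exact hRHS
    have hlam' : (geo9Y x).suppIn (Sum.inr J) y' := hlam
    have hsupN : 0 ≤ (geo9Y x).supNorm (Sum.inr J) := (modelSignsOn_geo9K x.toKIdx).supNorm_nonneg _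
    have hhol : 0 ≤ (geo9Y x).holder ε (Sum.inr J) := (modelSignsOn_geo9K x.toKIdx).holder_nonneg ε _
    set yL : IBondY x.toKIdx := ιB (β x.toKIdx.hN x.toKIdx.D x.toKIdx.hk y') with hyL
    have hyLβ : β x.toKIdx.hN x.toKIdx.D x.toKIdx.hk yL = β x.toKIdx.hN x.toKIdx.D x.toKIdx.hk y' := hι _
    have hlamL : (geo9Y x).suppIn (Sum.inr J) yL := fun q hq => by rw [hyLβ]; exact hlam' q hq
    rw [KACU_e4_inr_eq]
    show e4ReadB x.toKIdx TW U J (β x.toKIdx.hN x.toKIdx.D x.toKIdx.hk y) ≤ _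
    refine e4ReadB_le_of_forall x.toKIdx TW U J _ hRHS fun E ν μ q hq => ?_
    have hE1 : ‖(E : 𝔸)‖ ≤ 1 := mem_closedBall_zero_iff.1 E.2
    have hBS : BlockSupp (g := toB6 (geo9Y x) (0 : ℝ) True) (fun p : (Fin (d + 1) × SiteY x.toKIdx) × ι => blkC x.toKIdx ιB p.1.2)
        (coordEquiv b (bondFunCoordsY x.toKIdx (liftY J (E : 𝔸)))) yL (M₂ * (geo9Y x).supNorm (Sum.inr J)) :=
      blockSupp_coordEquiv_bondFun_liftY x.toKIdx b ιB hM₂ hrepr J y' hlam' hE1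
    set Dl : Module.End ℝ ((Fin (d + 1) × SiteY x.toKIdx) × ι → ℝ) := conj b (bondOpCoordsRY x.toKIdx (cdBₗ x.toKIdx U ν)) with hDl
    set Ds : Module.End ℝ ((Fin (d + 1) × SiteY x.toKIdx) × ι → ℝ) := conj b (bondOpCoordsRY x.toKIdx (cdsBₗ x.toKIdx U μ)) with hDs
    set N : ℝ := M₂ * (max (Bε ε) 0 * Real.exp (δc * (2 * ((d : ℝ) + 1))) * ((geo9Y x).holder ε (Sum.inr J) + (geo9Y x).supNorm (Sum.inr J))) with hN
    have hN0 : 0 ≤ N := by have := le_max_right (Bε ε) 0; positivity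
    have hN1 := fun k z => Ndata ε hε0 hε1 J yL hlamL E μ k z
    have hDlU : Dl = conj b (bondOpCoordsRY x.toKIdx (cdBₗ x.toKIdx U ν)) := rfl
    have hN2 : ∀ z : (Fin (d + 1) × SiteY x.toKIdx) × ι,
        |((Dl * GbC x.toKIdx par parB b (.base U) * Ds) (coordEquiv b (bondFunCoordsY x.toKIdx (liftY J (E : 𝔸))))) z| ≤
          N * Real.exp (-(δc * (geo9Y x).dist (blkC x.toKIdx ιB z.1.2) yL)) := by
      intro z
      have h := hN1 (Sum.inl ν) z
      rw [hDk, abs_apply_diffLetter_inl_mul_eq] at h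
      rw [hDl, hDs]; exact h
    have hout := HV Dl Ds (hmajL ν) (hmajR μ) yL _ _ hBS N hN0 hN1 hN2
    -- the value of the output word at `q` from its coordinates
    have hval : ‖cdB x.toKIdx U ν (TW (cdsB x.toKIdx U μ (liftY J (E : 𝔸)))) q‖ =
        ‖lamB x.toKIdx b ((Dl * GbC x.toKIdx par parB b ((codingYx G x C37 C38).bg.mul (.mult a) (.base U)) * Ds)
          (coordEquiv b (bondFunCoordsY x.toKIdx (liftY J (E : 𝔸))))) q‖ := by
      rw [hDl, hDs, lamB_DL_GbC_DR, lamB_coordEquiv_bondFunCoordsY]; rfl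
    rw [hval, lamB_apply']
    have hqblk : blkC x.toKIdx ιB (bondCoordsY x.toKIdx q).2 = ιB (β x.toKIdx.hN x.toKIdx.D x.toKIdx.hk y) := by
      rw [blkC_bondCoordsY_snd, hq]
    have hdistq : (geo9Y x).dist (ιB (β x.toKIdx.hN x.toKIdx.D x.toKIdx.hk y)) yL = (geo9Y x).dist y y' :=
      Node00.OpsYRead342.geo9K_dist_congr x.toKIdx (hι _) hyLβ
    refine (norm_coordSymm_apply_le b _ (bondCoordsY x.toKIdx q)
      (B * (N + M₂ * (geo9Y x).supNorm (Sum.inr J)) * Real.exp (-(δc / 7 * (geo9Y x).dist y y'))) fun j => ?_).trans ?_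
    · have h := hout (bondCoordsY x.toKIdx q, j)
      rw [hqblk, hdistq] at h
      exact h
    -- arithmetic
    have he0 : 0 ≤ Real.exp (-(δc / 7 * (geo9Y x).dist y y')) := (Real.exp_pos _).le
    have hNM : N + M₂ * (geo9Y x).supNorm (Sum.inr J) ≤
        M₂ * (max (Bε ε) 0 * Real.exp (δc * (2 * ((d : ℝ) + 1))) + 1) * ((geo9Y x).holder ε (Sum.inr J) + (geo9Y x).supNorm (Sum.inr J)) := by
      rw [hN]
      have h1 : M₂ * (geo9Y x).supNorm (Sum.inr J) ≤ M₂ * ((geo9Y x).holder ε (Sum.inr J) + (geo9Y x).supNorm (Sum.inr J)) :=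
        mul_le_mul_of_nonneg_left (le_add_of_nonneg_left hhol) hM₂
      nlinarith
    calc (∑ j, ‖b j‖) * (B * (N + M₂ * (geo9Y x).supNorm (Sum.inr J)) * Real.exp (-(δc / 7 * (geo9Y x).dist y y')))
        = (Sb * B) * (N + M₂ * (geo9Y x).supNorm (Sum.inr J)) * Real.exp (-(δc / 7 * (geo9Y x).dist y y')) := by rw [hSb]; ring
      _ ≤ (Sb * B) * (M₂ * (max (Bε ε) 0 * Real.exp (δc * (2 * ((d : ℝ) + 1))) + 1) * ((geo9Y x).holder ε (Sum.inr J) + (geo9Y x).supNorm (Sum.inr J))) *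
            Real.exp (-(δc / 7 * (geo9Y x).dist y y')) := mul_le_mul_of_nonneg_right (mul_le_mul_of_nonneg_left hNM (mul_nonneg hSb0 hB)) he0
      _ = wE4G6 (2 * ((d : ℝ) + 1)) Sb M₂ B δc Bε ε * Real.exp (-(δc / 7 * (geo9Y x).dist y y')) *
            ((geo9Y x).holder ε (Sum.inr J) + (geo9Y x).supNorm (Sum.inr J)) := by rw [wE4G6]; ring
  ------------------------------------------------------------------
  -- (3.45) at the product
  ------------------------------------------------------------------
  · intro ε β' lam ζ y y' hε0 hε1 hβ0 hβ1 hζ hlam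
    have hW : 0 ≤ wH2G6 (2 * ((d : ℝ) + 1)) Sb M₂ B δc Bβ Bε Bεβ ε β' := wH2G6_nonneg Bβ Bε Bεβ hSb0 hB hM₂ ε β'
    have hleny : 0 < (geo9Y x).len y := geo9Y_len_pos x y
    have hcutH : 0 ≤ (geo9Y x).cutH β' ζ := (modelSignsOn_geo9K x.toKIdx).cutH_nonneg β' ζ
    have hHS : 0 ≤ (geo9Y x).holder (β' + ε) lam + (geo9Y x).supNorm lam :=
      add_nonneg ((modelSignsOn_geo9K x.toKIdx).holder_nonneg _ lam) ((modelSignsOn_geo9K x.toKIdx).supNorm_nonneg lam)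
    have hRHS : 0 ≤ wH2G6 (2 * ((d : ℝ) + 1)) Sb M₂ B δc Bβ Bε Bεβ ε β' * (geo9Y x).len y ^ (-β') * (geo9Y x).cutH β' ζ *
        Real.exp (-(δc / 7 * (geo9Y x).dist y y')) * ((geo9Y x).holder (β' + ε) lam + (geo9Y x).supNorm lam) :=
      mul_nonneg (mul_nonneg (mul_nonneg (mul_nonneg hW (Real.rpow_nonneg hleny.le _)) hcutH) (Real.exp_pos _).le) hHS
    rcases lam with f | J
    · rw [(KACU_h2_off G x OA parB C37 C38 _ β').2 f ζ]; exact hRHS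
    rcases ζ with zs | z
    · rw [(KACU_h2_off G x OA parB C37 C38 _ β').1 J zs]; exact hRHS
    have hlam' : (geo9Y x).suppIn (Sum.inr J) y' := hlam
    have hsupN : 0 ≤ (geo9Y x).supNorm (Sum.inr J) := (modelSignsOn_geo9K x.toKIdx).supNorm_nonneg _
    have hhol : 0 ≤ (geo9Y x).holder ε (Sum.inr J) := (modelSignsOn_geo9K x.toKIdx).holder_nonneg ε _
    have hholb : 0 ≤ (geo9Y x).holder (β' + ε) (Sum.inr J) := (modelSignsOn_geo9K x.toKIdx).holder_nonneg _ _
    have hholmono : (geo9Y x).holder ε (Sum.inr J) ≤ (geo9Y x).holder (β' + ε) (Sum.inr J) := geo9K_holder_mono_bond x.toKIdx (by linarith) J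
    rw [KACU_h2_inr_eq]
    show h2ReadB x.toKIdx TW (parB U) U J β' z ≤ _
    -- the anchor: the labelled block of `y`, through a site of the block `βy`
    obtain ⟨w₀, hw₀⟩ := B6Geom246MultiLevelBox.exists_blkOf_eq x.toKIdx.D.toDomains (β x.toKIdx.hN x.toKIdx.D x.toKIdx.hk y)
    set y₁ : IBondY x.toKIdx := blkC x.toKIdx ιB w₀ with hy₁
    have hy₁' : y₁ = ιB (β x.toKIdx.hN x.toKIdx.D x.toKIdx.hk y) := by rw [hy₁]; show ιB (B9Eq360DeltaPrimeAY.blkY x.toKIdx w₀) = _; rw [← hw₀]; rfl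
    have hy₁β : β x.toKIdx.hN x.toKIdx.D x.toKIdx.hk y₁ = β x.toKIdx.hN x.toKIdx.D x.toKIdx.hk y := by rw [hy₁', hι]
    have hlen : (geo9Y x).len y₁ = (geo9Y x).len y := Node00.OpsYRead342.geo9K_len_congr x.toKIdx hy₁β
    have hdist : ∀ t : IBondY x.toKIdx, (geo9Y x).dist y₁ t = (geo9Y x).dist y t := fun t => Node00.OpsYRead342.geo9K_dist_congr x.toKIdx hy₁β rfl
    set yL : IBondY x.toKIdx := ιB (β x.toKIdx.hN x.toKIdx.D x.toKIdx.hk y') with hyL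
    have hyLβ : β x.toKIdx.hN x.toKIdx.D x.toKIdx.hk yL = β x.toKIdx.hN x.toKIdx.D x.toKIdx.hk y' := hι _
    have hlamL : (geo9Y x).suppIn (Sum.inr J) yL := fun q hq => by rw [hyLβ]; exact hlam' q hq
    have hdistL : (geo9Y x).dist y₁ yL = (geo9Y x).dist y y' := Node00.OpsYRead342.geo9K_dist_congr x.toKIdx hy₁β (hι _)
    have hleny₁ : 0 < (geo9Y x).len y₁ := geo9Y_len_pos x y₁
    haveI : Nontrivial 𝔸 := NormOneClass.nontrivial
    obtain ⟨j₀⟩ := b.index_nonempty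
    have hp₀ : blkC x.toKIdx ιB ((((0 : Fin (d + 1)), w₀), j₀) : (Fin (d + 1) × SiteY x.toKIdx) × ι).1.2 = y₁ := rfl
    -- constants
    set cζ : ℝ := (geo9Y x).cutH β' (Sum.inr z) with hcζ
    have hcζ0 : 0 ≤ cζ := hcutH
    set Bp : ℝ := max (Bβ β') 0 with hBp
    have hBp0 : 0 ≤ Bp := le_max_right _ _
    set Bpe : ℝ := max (Bε ε) 0 with hBpe
    have hBpe0 : 0 ≤ Bpe := le_max_right _ _
    set Bp2 : ℝ := max (Bεβ ε β') 0 with hBp2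
    have hBp20 : 0 ≤ Bp2 := le_max_right _ _
    set BhL : ℝ := Sb * Bp with hBhL
    have hBhL0 : 0 ≤ BhL := mul_nonneg hSb0 hBp0
    set HS : ℝ := (geo9Y x).holder (β' + ε) (Sum.inr J) + (geo9Y x).supNorm (Sum.inr J) with hHSdef
    have hHS0 : 0 ≤ HS := add_nonneg hholb hsupN
    -- the (3.43) block at the base READ (exponent β′), at the call rate
    set Wf : IBondY x.toKIdx → ℝ := fun a' => Bp * (geo9Y x).len y₁ ^ (1 - β') * cζ * Real.exp (-(δc * (geo9Y x).dist y₁ a')) with hWf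
    have hWf0 : ∀ a', 0 ≤ Wf a' := fun a' =>
      mul_nonneg (mul_nonneg (mul_nonneg hBp0 (Real.rpow_nonneg hleny₁.le _)) hcζ0) (Real.exp_pos _).le
    have hreadU : ∀ (g : FBondY x.toKIdx → ℝ) (a' : IBondY x.toKIdx), (geo9Y x).suppIn (Sum.inr g) a' →
        h1ReadB x.toKIdx TU (parB U) U g β' z ≤ Wf a' * (geo9Y x).supNorm (Sum.inr g) := by
      intro g a' hg
      have h := hH1U β' (Sum.inr g) (Sum.inr z) y a' hβ0 hβ1 hζ hg
      rw [KACU_h1_inr_eq] at h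
      have hN : 0 ≤ (geo9Y x).supNorm (Sum.inr g) := (modelSignsOn_geo9K x.toKIdx).supNorm_nonneg _
      refine (show h1ReadB x.toKIdx TU (parB U) U g β' z ≤ _ from h).trans ?_
      rw [← hlen, ← hdist]
      have hP : 0 ≤ (geo9Y x).len y₁ ^ (1 - β') * cζ := mul_nonneg (Real.rpow_nonneg hleny₁.le _) hcζ0
      have hexp : Real.exp (-(δ * (geo9Y x).dist y₁ a')) ≤ Real.exp (-(δc * (geo9Y x).dist y₁ a')) :=
        Real.exp_le_exp.2 (by nlinarith [hdn y₁ a'])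
      calc Bβ β' * (geo9Y x).len y₁ ^ (1 - β') * (geo9Y x).cutH β' (Sum.inr z) * Real.exp (-(δ * (geo9Y x).dist y₁ a')) *
            (geo9Y x).supNorm (Sum.inr g)
          = Bβ β' * (((geo9Y x).len y₁ ^ (1 - β') * cζ) * Real.exp (-(δ * (geo9Y x).dist y₁ a')) * (geo9Y x).supNorm (Sum.inr g)) := by
            rw [hcζ]; ring
        _ ≤ Bp * (((geo9Y x).len y₁ ^ (1 - β') * cζ) * Real.exp (-(δc * (geo9Y x).dist y₁ a')) * (geo9Y x).supNorm (Sum.inr g)) := by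
            refine mul_le_mul (le_max_left _ _) ?_ (mul_nonneg (mul_nonneg hP (Real.exp_pos _).le) hN) hBp0
            exact mul_le_mul_of_nonneg_right (mul_le_mul_of_nonneg_left hexp hP) hN
        _ = Wf a' * (geo9Y x).supNorm (Sum.inr g) := by rw [hWf]; ring
    refine h2ReadB_le_of_probes x.toKIdx TW (parB U) U J β' z hRHS fun E ν μ q q' hadm => ?_
    have hE1 : ‖(E : 𝔸)‖ ≤ 1 := mem_closedBall_zero_iff.1 E.2
    have hBS : BlockSupp (g := toB6 (geo9Y x) (0 : ℝ) True) (fun p : (Fin (d + 1) × SiteY x.toKIdx) × ι => blkC x.toKIdx ιB p.1.2)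
        (coordEquiv b (bondFunCoordsY x.toKIdx (liftY J (E : 𝔸)))) yL (M₂ * (geo9Y x).supNorm (Sum.inr J)) :=
      blockSupp_coordEquiv_bondFun_liftY x.toKIdx b ιB hM₂ hrepr J y' hlam' hE1
    set Dl : Module.End ℝ ((Fin (d + 1) × SiteY x.toKIdx) × ι → ℝ) := conj b (bondOpCoordsRY x.toKIdx (cdBₗ x.toKIdx U ν)) with hDl
    set Ds : Module.End ℝ ((Fin (d + 1) × SiteY x.toKIdx) × ι → ℝ) := conj b (bondOpCoordsRY x.toKIdx (cdsBₗ x.toKIdx U μ)) with hDs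
    set Φ : (Fin (d + 1) × SiteY x.toKIdx → 𝔸) →ₗ[ℝ] 𝔸 := probeBC x.toKIdx (parB U) β' z q q' with hΦ
    -- the LEFT (3.43) premise for `D_l·G(U)`
    have prem : ∀ (y'' : IBondY x.toKIdx) (μ' : (Fin (d + 1) × SiteY x.toKIdx) × ι → ℝ) (C : ℝ),
        BlockSupp (g := toB6 (geo9Y x) (0 : ℝ) True) (fun q : (Fin (d + 1) × SiteY x.toKIdx) × ι => blkC x.toKIdx ιB q.1.2) μ' y'' C →
        ‖Φ ((coordEquiv b).symm (Dl (GbC x.toKIdx par parB b (.base U) μ')))‖ ≤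
          BhL * (geo9Y x).len y₁ ^ (1 - β') * cζ * Real.exp (-(δc * (geo9Y x).dist y₁ y'')) * C := by
      intro y'' μ' C hμ
      calc ‖Φ ((coordEquiv b).symm (Dl (GbC x.toKIdx par parB b (.base U) μ')))‖
          = ‖probeB x.toKIdx (parB U) β' z q q' (cdB x.toKIdx U ν (TU (lamB x.toKIdx b μ')))‖ := by
            rw [hΦ, probeBC_symm, ← Module.End.mul_apply, hDl, lamB_DL_GbC, decY_base]
        _ ≤ Sb * (Wf y'' * C) := probeL_lamB_le x.toKIdx b ιB TU (parB U) U hι hM₂ hrepr β' z hWf0 hreadU hμ ν hadm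
        _ = BhL * (geo9Y x).len y₁ ^ (1 - β') * cζ * Real.exp (-(δc * (geo9Y x).dist y₁ y'')) * C := by rw [hWf, hBhL]; ring
    -- the sup data `N`
    set N : ℝ := M₂ * (Bpe * Real.exp (δc * (2 * ((d : ℝ) + 1))) * ((geo9Y x).holder ε (Sum.inr J) + (geo9Y x).supNorm (Sum.inr J))) with hN
    have hN0 : 0 ≤ N := by positivity
    have hN1 := fun k zz => Ndata ε hε0 hε1 J yL hlamL E μ k zz
    -- the probe data `N₂` of the unperturbed word, from the (3.45) block at the base
    set N₂ : ℝ := Bp2 * (geo9Y x).len y₁ ^ (-β') * cζ * HS with hN₂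
    have hN₂0 : 0 ≤ N₂ := mul_nonneg (mul_nonneg (mul_nonneg hBp20 (Real.rpow_nonneg hleny₁.le _)) hcζ0) hHS0
    have hN2 : ‖Φ ((coordEquiv b).symm ((Dl * GbC x.toKIdx par parB b (.base U) * Ds) (coordEquiv b (bondFunCoordsY x.toKIdx (liftY J (E : 𝔸))))))‖ ≤
        N₂ * Real.exp (-(δc * (geo9Y x).dist y₁ yL)) := by
      have hbr : ‖Φ ((coordEquiv b).symm ((Dl * GbC x.toKIdx par parB b (.base U) * Ds) (coordEquiv b (bondFunCoordsY x.toKIdx (liftY J (E : 𝔸))))))‖ =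
          ‖probeB x.toKIdx (parB U) β' z q q' (cdB x.toKIdx U ν (TU (cdsB x.toKIdx U μ (liftY J (E : 𝔸)))))‖ := by
        rw [hΦ, probeBC_symm, hDl, hDs, lamB_DL_GbC_DR, decY_base, lamB_coordEquiv_bondFunCoordsY]
      rw [hbr]
      have h := hH2U ε β' (Sum.inr J) (Sum.inr z) y y' hε0 hε1 hβ0 hβ1 hζ hlam'
      rw [KACU_h2_inr_eq] at h
      have hr := probe_le_h2ReadB x.toKIdx b TU U (parB U) hM₂ hrepr J β' z E ν μ hadm
      refine (hr.trans h).trans ?_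
      rw [hN₂, hdistL, hlen, hHSdef]
      have hP : 0 ≤ (geo9Y x).len y ^ (-β') * (geo9Y x).cutH β' (Sum.inr z) := mul_nonneg (Real.rpow_nonneg hleny.le _) hcutH
      have hexp : Real.exp (-(δ * (geo9Y x).dist y y')) ≤ Real.exp (-(δc * (geo9Y x).dist y y')) := Real.exp_le_exp.2 (by nlinarith [hdn y y'])
      calc Bεβ ε β' * (geo9Y x).len y ^ (-β') * (geo9Y x).cutH β' (Sum.inr z) * Real.exp (-(δ * (geo9Y x).dist y y')) *
            ((geo9Y x).holder (β' + ε) (Sum.inr J) + (geo9Y x).supNorm (Sum.inr J))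
          = Bεβ ε β' * (((geo9Y x).len y ^ (-β') * (geo9Y x).cutH β' (Sum.inr z)) * Real.exp (-(δ * (geo9Y x).dist y y')) *
              ((geo9Y x).holder (β' + ε) (Sum.inr J) + (geo9Y x).supNorm (Sum.inr J))) := by ring
        _ ≤ Bp2 * (((geo9Y x).len y ^ (-β') * (geo9Y x).cutH β' (Sum.inr z)) * Real.exp (-(δc * (geo9Y x).dist y y')) *
              ((geo9Y x).holder (β' + ε) (Sum.inr J) + (geo9Y x).supNorm (Sum.inr J))) := by
            refine mul_le_mul (le_max_left _ _) ?_ (mul_nonneg (mul_nonneg hP (Real.exp_pos _).le) hHS0) hBp20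
            exact mul_le_mul_of_nonneg_right (mul_le_mul_of_nonneg_left hexp hP) hHS0
        _ = Bp2 * (geo9Y x).len y ^ (-β') * cζ * ((geo9Y x).holder (β' + ε) (Sum.inr J) + (geo9Y x).supNorm (Sum.inr J)) *
              Real.exp (-(δc * (geo9Y x).dist y y')) := by rw [hcζ]; ring
    -- the transfer
    have hout := HVI Dl Ds (hmajL ν) (hmajR μ) Φ y₁ _ hp₀ β' BhL cζ hBhL0 hcζ0 prem yL _ _ hBS N hN0 hN1 N₂ hN₂0 hN2
    have hval : ‖probeB x.toKIdx (parB U) β' z q q' (cdB x.toKIdx U ν (TW (cdsB x.toKIdx U μ (liftY J (E : 𝔸)))))‖ =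
        ‖Φ ((coordEquiv b).symm ((Dl * GbC x.toKIdx par parB b ((codingYx G x C37 C38).bg.mul (.mult a) (.base U)) * Ds)
          (coordEquiv b (bondFunCoordsY x.toKIdx (liftY J (E : 𝔸))))))‖ := by
      rw [hΦ, probeBC_symm, hDl, hDs, lamB_DL_GbC_DR, lamB_coordEquiv_bondFunCoordsY]; rfl
    rw [hval]
    refine hout.trans ?_
    -- arithmetic: `B·(N₂ + B_hL·ℓ^{1−β′}·cζ·ℓ⁻¹·(N + M₂|J|))·e ≦ wH2G6 ε β′ · ℓ^{−β′} · cζ · e · HS`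
    rw [hdistL, hlen]
    set L₁ : ℝ := (geo9Y x).len y with hL₁
    set ee : ℝ := Real.exp (-(δc / 7 * (geo9Y x).dist y y')) with hee
    have hee0 : 0 ≤ ee := (Real.exp_pos _).le
    have hLpow : L₁ ^ (1 - β') * L₁⁻¹ = L₁ ^ (-β') := by
      rw [← Real.rpow_neg_one, ← Real.rpow_add hleny]; ring_nf
    have hNM : N + M₂ * (geo9Y x).supNorm (Sum.inr J) ≤ M₂ * (Bpe * Real.exp (δc * (2 * ((d : ℝ) + 1))) + 1) * HS := by
      rw [hN, hHSdef]
      have h1 : (geo9Y x).holder ε (Sum.inr J) + (geo9Y x).supNorm (Sum.inr J) ≤ (geo9Y x).holder (β' + ε) (Sum.inr J) + (geo9Y x).supNorm (Sum.inr J) := by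
        linarith
      have h2 : M₂ * (geo9Y x).supNorm (Sum.inr J) ≤ M₂ * ((geo9Y x).holder (β' + ε) (Sum.inr J) + (geo9Y x).supNorm (Sum.inr J)) :=
        mul_le_mul_of_nonneg_left (le_add_of_nonneg_left hholb) hM₂
      have h3 : M₂ * (Bpe * Real.exp (δc * (2 * ((d : ℝ) + 1))) * ((geo9Y x).holder ε (Sum.inr J) + (geo9Y x).supNorm (Sum.inr J))) ≤
          M₂ * (Bpe * Real.exp (δc * (2 * ((d : ℝ) + 1))) * ((geo9Y x).holder (β' + ε) (Sum.inr J) + (geo9Y x).supNorm (Sum.inr J))) :=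
        mul_le_mul_of_nonneg_left (mul_le_mul_of_nonneg_left h1 (by positivity)) hM₂
      nlinarith
    have hNMnn : 0 ≤ N + M₂ * (geo9Y x).supNorm (Sum.inr J) := add_nonneg hN0 (mul_nonneg hM₂ hsupN)
    have hmid : BhL * L₁ ^ (1 - β') * cζ * L₁⁻¹ * (N + M₂ * (geo9Y x).supNorm (Sum.inr J)) ≤
        (Sb * Bp * M₂ * (Bpe * Real.exp (δc * (2 * ((d : ℝ) + 1))) + 1)) * (L₁ ^ (-β') * cζ * HS) := by
      calc BhL * L₁ ^ (1 - β') * cζ * L₁⁻¹ * (N + M₂ * (geo9Y x).supNorm (Sum.inr J))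
          = BhL * (L₁ ^ (1 - β') * L₁⁻¹) * cζ * (N + M₂ * (geo9Y x).supNorm (Sum.inr J)) := by ring
        _ = BhL * L₁ ^ (-β') * cζ * (N + M₂ * (geo9Y x).supNorm (Sum.inr J)) := by rw [hLpow]
        _ ≤ BhL * L₁ ^ (-β') * cζ * (M₂ * (Bpe * Real.exp (δc * (2 * ((d : ℝ) + 1))) + 1) * HS) :=
            mul_le_mul_of_nonneg_left hNM (mul_nonneg (mul_nonneg hBhL0 (Real.rpow_nonneg hleny.le _)) hcζ0)
        _ = (Sb * Bp * M₂ * (Bpe * Real.exp (δc * (2 * ((d : ℝ) + 1))) + 1)) * (L₁ ^ (-β') * cζ * HS) := by rw [hBhL]; ring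
    have hN₂' : N₂ = Bp2 * (L₁ ^ (-β') * cζ * HS) := by rw [hN₂, hlen]; ring
    calc B * (N₂ + BhL * L₁ ^ (1 - β') * cζ * L₁⁻¹ * (N + M₂ * (geo9Y x).supNorm (Sum.inr J))) * ee
        ≤ B * (Bp2 * (L₁ ^ (-β') * cζ * HS) + (Sb * Bp * M₂ * (Bpe * Real.exp (δc * (2 * ((d : ℝ) + 1))) + 1)) * (L₁ ^ (-β') * cζ * HS)) * ee := by
          rw [hN₂']
          exact mul_le_mul_of_nonneg_right (mul_le_mul_of_nonneg_left (add_le_add le_rfl hmid) hB) hee0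
      _ = wH2G6 (2 * ((d : ℝ) + 1)) Sb M₂ B δc Bβ Bε Bεβ ε β' * L₁ ^ (-β') * cζ * ee * HS := by
          rw [wH2G6, ← hBp, ← hBpe, ← hBp2]; ring

end Transfer

/-! ## §4 ★★★ The frame instance over the coded carriers of a subfamily and the (3.44) ∕ (3.45) block-steps of the bond family -/

section Steps

variable [NormOneClass 𝔸] [FiniteDimensional ℝ 𝔸] {J : Type} (f : J → MemberY d ℓ hd hL b₀ b₁ Mstar)
  [∀ x : MemberY d ℓ hd hL b₀ b₁ Mstar, Fintype (geo9Y x).Site]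
  [instDS : ∀ x : MemberY d ℓ hd hL b₀ b₁ Mstar, DecidableEq (geo9Y x).Site] [instNE : ∀ x : MemberY d ℓ hd hL b₀ b₁ Mstar, Nonempty (geo9Y x).Site]
  (c35 : ℝ) (G : Subgroup 𝔸ˣ) (par : ∀ j : J, SiteParY 𝔸 (f j).toKIdx) (parB : ∀ j : J, BondParY 𝔸 (f j).toKIdx)
  {ι : Type} [Fintype ι] [DecidableEq ι] (b : Module.Basis ι ℝ 𝔸) (ιB : ∀ j : J, BlkY (f j).toKIdx → IBondY (f j).toKIdx)
  (C37 C38 : ∀ j : J, ℝ → CfgY 𝔸 (f j).toKIdx → AfldY 𝔸 (f j).toKIdx → Prop)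

/-- ★★★ **THE (3.44) ∕ (3.45) BOND-SECTOR FRAME OVER THE CODED CARRIERS OF A SUBFAMILY, INHABITED FOR `KACU`**: gen 13's instance `gFrame₅CodedOn` extended by the
writing functions `wE4G6` ∕ `wH2G6`, the rate `wHGδ' δc = δc∕7`, and the transfer field `e4h2G_transfer_KACU`.  NO hypothesis beyond `gFrame₅CodedOn`'s binders.
[cite: Balaban1985BackgroundPropagators, Thm 3.4 p.400, Thm 3.3 p.399, (3.44)–(3.45) p.398, p.403 l.2–5, (3.82)–(3.86) p.407; Balaban1984PropagatorsII, Lemma 2.1 p.234, (2.51)–(2.52) p.232] -/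
noncomputable def e4h2GFrame₆CodedOn (hι : ∀ (j : J) (s : BlkY (f j).toKIdx), β (f j).toKIdx.hN (f j).toKIdx.D (f j).toKIdx.hk (ιB j s) = s)
    (hG1 : ∀ u : 𝔸ˣ, u ∈ G → ‖(u : 𝔸)‖ ≤ 1) (hpar : ∀ j (U : CfgY 𝔸 (f j).toKIdx), GVal G (f j).toKIdx U → ∀ z w, par j U z w ∈ G)
    (hunit : ∀ j (U : CfgY 𝔸 (f j).toKIdx), GVal G (f j).toKIdx U → IsUnit (deltaPrimeAY (f j).toKIdx (par j) U))
    (M₂ : ℝ) (hM₂ : 0 ≤ M₂) (hrepr : ∀ (v : 𝔸) (j : ι), |b.repr v j| ≤ M₂ * ‖v‖) (hcR : 0 < M₂ * ∑ j, ‖b j‖)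
    (Cq : ℝ) (hCq : 0 ≤ Cq) (hC37 : ∀ j β' U a, C37 j β' U a → GVal G (f j).toKIdx U ∧ CplxLettersY G (f j) (par j) (ιB j) Cq β' U a)
    (MInv aInv aW : ℝ) (hMInv : 0 < MInv) (haInv : 0 < aInv) (haW : 0 < aW)
    (hunitX : ∀ j (U : CfgY 𝔸 (f j).toKIdx), GVal G (f j).toKIdx U → IsUnit (XY (f j).toKIdx (par j) (GpY (f j).toKIdx (par j)) U))
    (hsym : ∀ j (U : CfgY 𝔸 (f j).toKIdx) (z w : SiteY (f j).toKIdx), par j U z w = (par j U w z)⁻¹)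
    (hunitA : ∀ j (U : CfgY 𝔸 (f j).toKIdx), GVal G (f j).toKIdx U → IsUnit (deltaAY (f j).toKIdx (par j) (parB j) (GpY (f j).toKIdx (par j)) U))
    (hparB : ∀ j (U : CfgY 𝔸 (f j).toKIdx), GVal G (f j).toKIdx U → ∀ y f', parB j U y f' ∈ G) (hb₁ : 0 ≤ b₁)
    (C₀ : ℝ) (hC₀ : 0 ≤ C₀)
    (hreg335P : ∀ j (α₀ : ℝ) (U : CfgY 𝔸 (f j).toKIdx), MInv ≤ (geo9Y (f j)).M → 0 < α₀ → (geo9Y (f j)).M * α₀ ≤ aInv →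
      (bg9Y 𝔸 G (f j)).Reg335 c35 α₀ U → Reg335PlaqY G (f j) (ιB j) C₀ U)
    (hC37G : ∀ j β' U a, C37 j β' U a → CplxLettersGY G (f j) (ιB j) β' U a)
    (cVar : ℝ) (hcVar : 0 ≤ cVar) (hvarB : ∀ j β' U a, C37 j β' U a → VarParBY (f j).toKIdx (parB j) cVar β' U a)
    (hMd : 2 * ((d : ℝ) + 1) < MInv) (mN : ℕ) (hnbr : ∀ (j : J) (y' : IBondY (f j).toKIdx), (nbr (geo9Y (f j)) (2 * ((d : ℝ) + 1)) y').card ≤ mN) :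
    E4H2GFrame₆ c35 (fun j => geo9Y (f j)) (fun j => (codingYx G (f j) (C37 j) (C38 j)).bg) (fun j => KSC G (f j) (par j) (C37 j) (C38 j)) b (Fin (d + 1))
      (fun j => SiteY (f j).toKIdx) (fun j => BlkY (f j).toKIdx × ι)
      (fun j => KACU G (f j) (GAY (f j).toKIdx (par j) (parB j) (GpY (f j).toKIdx (par j))) (parB j) (C37 j) (C38 j))
      (fun j => pullS (codingYx G (f j) (C37 j) (C38 j)) (CinvY f G par j)) :=
  { gFrame₅CodedOn f c35 G par parB b ιB C37 C38 hι hG1 hpar hunit M₂ hM₂ hrepr hcR Cq hCq hC37 MInv aInv aW hMInv haInv haW hunitX hsym hunitA hparB hb₁ C₀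
      hC₀ hreg335P hC37G cVar hcVar hvarB hMd mN hnbr with
    wE4G := fun B δc Bε => wE4G6 (2 * ((d : ℝ) + 1)) (∑ j, ‖b j‖) M₂ B δc Bε
    wH2G := fun B δc Bβ Bε Bεβ => wH2G6 (2 * ((d : ℝ) + 1)) (∑ j, ‖b j‖) M₂ B δc Bβ Bε Bεβ
    wHGδ' := fun δc => δc / 7
    wHGδ'_pos := fun δc hδc => by positivity
    e4h2G_transfer := fun j α₀ c c' α₁ B₀ B δ δc Bβ Bε Bεβ hM hα₀ hMa hreg hα₁ haW' h37 hB₀ hB hδ hδc hδcδ hE hHH HV HVI =>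
      e4h2G_transfer_KACU c35 G (f j) (par j) (parB j) b (ιB j) (C37 j) (C38 j) (hι j) hG1 hM₂ hrepr
        (fun δ' => M₂ * (∑ j, ‖b j‖) + cXY (d := d) (ℓ := ℓ) b M₂ mN δ') α₀ c c' α₁ B₀ B δ δc Bβ Bε Bεβ hM hα₀ hMa hreg hα₁ haW' h37 hB₀ hB hδ hδc hδcδ
        (le_add_of_nonneg_right (cXY_nonneg (d := d) (ℓ := ℓ) b hM₂ mN δ)) hE hHH HV HVI }

/-- ★★ **`StepE4Pos` OF THE CODED BOND FAMILY `KACU` THROUGH THE FRAME — THE (3.44) MEMBER OF THE SECT.-B STEP OF RECORD, G SIDE** (r06's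
`stepE4Pos_of_e4h2GFrame₆` on `e4h2GFrame₆CodedOn`), GIVEN the Lemma-2.1 datum of the frame.
[cite: Balaban1985BackgroundPropagators, Thm 3.4 p.400, Thm 3.3 p.399, (3.44) p.398, (3.82)–(3.86) p.407; Balaban1984PropagatorsII, Lemma 2.1 p.234, (2.51) p.232] -/
theorem stepE4Pos_KACU_frame_on (hι : ∀ (j : J) (s : BlkY (f j).toKIdx), β (f j).toKIdx.hN (f j).toKIdx.D (f j).toKIdx.hk (ιB j s) = s)
    (hG1 : ∀ u : 𝔸ˣ, u ∈ G → ‖(u : 𝔸)‖ ≤ 1) (hpar : ∀ j (U : CfgY 𝔸 (f j).toKIdx), GVal G (f j).toKIdx U → ∀ z w, par j U z w ∈ G)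
    (hunit : ∀ j (U : CfgY 𝔸 (f j).toKIdx), GVal G (f j).toKIdx U → IsUnit (deltaPrimeAY (f j).toKIdx (par j) U))
    (M₂ : ℝ) (hM₂ : 0 ≤ M₂) (hrepr : ∀ (v : 𝔸) (j : ι), |b.repr v j| ≤ M₂ * ‖v‖) (hcR : 0 < M₂ * ∑ j, ‖b j‖)
    (Cq : ℝ) (hCq : 0 ≤ Cq) (hC37 : ∀ j β' U a, C37 j β' U a → GVal G (f j).toKIdx U ∧ CplxLettersY G (f j) (par j) (ιB j) Cq β' U a)
    (MInv aInv aW : ℝ) (hMInv : 0 < MInv) (haInv : 0 < aInv) (haW : 0 < aW)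
    (hunitX : ∀ j (U : CfgY 𝔸 (f j).toKIdx), GVal G (f j).toKIdx U → IsUnit (XY (f j).toKIdx (par j) (GpY (f j).toKIdx (par j)) U))
    (hsym : ∀ j (U : CfgY 𝔸 (f j).toKIdx) (z w : SiteY (f j).toKIdx), par j U z w = (par j U w z)⁻¹)
    (hunitA : ∀ j (U : CfgY 𝔸 (f j).toKIdx), GVal G (f j).toKIdx U → IsUnit (deltaAY (f j).toKIdx (par j) (parB j) (GpY (f j).toKIdx (par j)) U))
    (hparB : ∀ j (U : CfgY 𝔸 (f j).toKIdx), GVal G (f j).toKIdx U → ∀ y f', parB j U y f' ∈ G) (hb₁ : 0 ≤ b₁)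
    (C₀ : ℝ) (hC₀ : 0 ≤ C₀)
    (hreg335P : ∀ j (α₀ : ℝ) (U : CfgY 𝔸 (f j).toKIdx), MInv ≤ (geo9Y (f j)).M → 0 < α₀ → (geo9Y (f j)).M * α₀ ≤ aInv →
      (bg9Y 𝔸 G (f j)).Reg335 c35 α₀ U → Reg335PlaqY G (f j) (ιB j) C₀ U)
    (hC37G : ∀ j β' U a, C37 j β' U a → CplxLettersGY G (f j) (ιB j) β' U a)
    (cVar : ℝ) (hcVar : 0 ≤ cVar) (hvarB : ∀ j β' U a, C37 j β' U a → VarParBY (f j).toKIdx (parB j) cVar β' U a)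
    (hMd : 2 * ((d : ℝ) + 1) < MInv) (mN : ℕ) (hnbr : ∀ (j : J) (y' : IBondY (f j).toKIdx), (nbr (geo9Y (f j)) (2 * ((d : ℝ) + 1)) y').card ≤ mN) (d261 : ℝ → ℕ)
    (h261 : ∀ (j : J) (δ α : ℝ), 0 < δ → δ ≤ 1 → 9 / 5000 ≤ α → α < 1 →
      (e4h2GFrame₆CodedOn f c35 G par parB b ιB C37 C38 hι hG1 hpar hunit M₂ hM₂ hrepr hcR Cq hCq hC37 MInv aInv aW hMInv haInv haW hunitX hsym hunitA hparB hb₁ C₀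
      hC₀ hreg335P hC37G cVar hcVar hvarB hMd mN hnbr).M261 δ ≤ (geo9Y (f j)).M → Ineq261 (d261 δ) (toB6 (geo9Y (f j)) 0 True) δ α) :
    StepE4Pos (d + 1) c35 (fun j => geo9Y (f j)) (fun j => (codingYx G (f j) (C37 j) (C38 j)).bg) (fun j => KSC G (f j) (par j) (C37 j) (C38 j))
      (fun j => KACU G (f j) (GAY (f j).toKIdx (par j) (parB j) (GpY (f j).toKIdx (par j))) (parB j) (C37 j) (C38 j))
      (fun j => pullS (codingYx G (f j) (C37 j) (C38 j)) (CinvY f G par j))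
      (fun j => KACU G (f j) (GAY (f j).toKIdx (par j) (parB j) (GpY (f j).toKIdx (par j))) (parB j) (C37 j) (C38 j)) :=
  B9SectBE4H2GFrameV6.stepE4Pos_of_e4h2GFrame₆ (F := e4h2GFrame₆CodedOn f c35 G par parB b ιB C37 C38 hι hG1 hpar hunit M₂ hM₂ hrepr hcR Cq hCq hC37 MInv aInv aW hMInv haInv haW hunitX hsym hunitA hparB hb₁ C₀
      hC₀ hreg335P hC37G cVar hcVar hvarB hMd mN hnbr) d261 h261

/-- ★★ **`StepH2Pos` OF THE CODED BOND FAMILY `KACU` THROUGH THE FRAME — THE (3.45) MEMBER OF THE SECT.-B STEP OF RECORD, G SIDE** (r06's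
`stepH2Pos_of_e4h2GFrame₆` on `e4h2GFrame₆CodedOn`), GIVEN the Lemma-2.1 datum of the frame.
[cite: Balaban1985BackgroundPropagators, Thm 3.4 p.400, Thm 3.3 p.399, (3.45) p.398, (3.82)–(3.86) p.407; Balaban1984PropagatorsII, Lemma 2.1 p.234, (2.51) p.232] -/
theorem stepH2Pos_KACU_frame_on (hι : ∀ (j : J) (s : BlkY (f j).toKIdx), β (f j).toKIdx.hN (f j).toKIdx.D (f j).toKIdx.hk (ιB j s) = s)
    (hG1 : ∀ u : 𝔸ˣ, u ∈ G → ‖(u : 𝔸)‖ ≤ 1) (hpar : ∀ j (U : CfgY 𝔸 (f j).toKIdx), GVal G (f j).toKIdx U → ∀ z w, par j U z w ∈ G)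
    (hunit : ∀ j (U : CfgY 𝔸 (f j).toKIdx), GVal G (f j).toKIdx U → IsUnit (deltaPrimeAY (f j).toKIdx (par j) U))
    (M₂ : ℝ) (hM₂ : 0 ≤ M₂) (hrepr : ∀ (v : 𝔸) (j : ι), |b.repr v j| ≤ M₂ * ‖v‖) (hcR : 0 < M₂ * ∑ j, ‖b j‖)
    (Cq : ℝ) (hCq : 0 ≤ Cq) (hC37 : ∀ j β' U a, C37 j β' U a → GVal G (f j).toKIdx U ∧ CplxLettersY G (f j) (par j) (ιB j) Cq β' U a)
    (MInv aInv aW : ℝ) (hMInv : 0 < MInv) (haInv : 0 < aInv) (haW : 0 < aW)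
    (hunitX : ∀ j (U : CfgY 𝔸 (f j).toKIdx), GVal G (f j).toKIdx U → IsUnit (XY (f j).toKIdx (par j) (GpY (f j).toKIdx (par j)) U))
    (hsym : ∀ j (U : CfgY 𝔸 (f j).toKIdx) (z w : SiteY (f j).toKIdx), par j U z w = (par j U w z)⁻¹)
    (hunitA : ∀ j (U : CfgY 𝔸 (f j).toKIdx), GVal G (f j).toKIdx U → IsUnit (deltaAY (f j).toKIdx (par j) (parB j) (GpY (f j).toKIdx (par j)) U))
    (hparB : ∀ j (U : CfgY 𝔸 (f j).toKIdx), GVal G (f j).toKIdx U → ∀ y f', parB j U y f' ∈ G) (hb₁ : 0 ≤ b₁)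
    (C₀ : ℝ) (hC₀ : 0 ≤ C₀)
    (hreg335P : ∀ j (α₀ : ℝ) (U : CfgY 𝔸 (f j).toKIdx), MInv ≤ (geo9Y (f j)).M → 0 < α₀ → (geo9Y (f j)).M * α₀ ≤ aInv →
      (bg9Y 𝔸 G (f j)).Reg335 c35 α₀ U → Reg335PlaqY G (f j) (ιB j) C₀ U)
    (hC37G : ∀ j β' U a, C37 j β' U a → CplxLettersGY G (f j) (ιB j) β' U a)
    (cVar : ℝ) (hcVar : 0 ≤ cVar) (hvarB : ∀ j β' U a, C37 j β' U a → VarParBY (f j).toKIdx (parB j) cVar β' U a)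
    (hMd : 2 * ((d : ℝ) + 1) < MInv) (mN : ℕ) (hnbr : ∀ (j : J) (y' : IBondY (f j).toKIdx), (nbr (geo9Y (f j)) (2 * ((d : ℝ) + 1)) y').card ≤ mN) (d261 : ℝ → ℕ)
    (h261 : ∀ (j : J) (δ α : ℝ), 0 < δ → δ ≤ 1 → 9 / 5000 ≤ α → α < 1 →
      (e4h2GFrame₆CodedOn f c35 G par parB b ιB C37 C38 hι hG1 hpar hunit M₂ hM₂ hrepr hcR Cq hCq hC37 MInv aInv aW hMInv haInv haW hunitX hsym hunitA hparB hb₁ C₀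
      hC₀ hreg335P hC37G cVar hcVar hvarB hMd mN hnbr).M261 δ ≤ (geo9Y (f j)).M → Ineq261 (d261 δ) (toB6 (geo9Y (f j)) 0 True) δ α) :
    StepH2Pos (d + 1) c35 (fun j => geo9Y (f j)) (fun j => (codingYx G (f j) (C37 j) (C38 j)).bg) (fun j => KSC G (f j) (par j) (C37 j) (C38 j))
      (fun j => KACU G (f j) (GAY (f j).toKIdx (par j) (parB j) (GpY (f j).toKIdx (par j))) (parB j) (C37 j) (C38 j))
      (fun j => pullS (codingYx G (f j) (C37 j) (C38 j)) (CinvY f G par j))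
      (fun j => KACU G (f j) (GAY (f j).toKIdx (par j) (parB j) (GpY (f j).toKIdx (par j))) (parB j) (C37 j) (C38 j)) :=
  B9SectBE4H2GFrameV6.stepH2Pos_of_e4h2GFrame₆ (F := e4h2GFrame₆CodedOn f c35 G par parB b ιB C37 C38 hι hG1 hpar hunit M₂ hM₂ hrepr hcR Cq hCq hC37 MInv aInv aW hMInv haInv haW hunitX hsym hunitA hparB hb₁ C₀
      hC₀ hreg335P hC37G cVar hcVar hvarB hMd mN hnbr) d261 h261

end Steps

end Literature.MathematicalPhysics.QuantumFieldTheory.Balaban1983to89.B9SectBE4H2GFrameCodedY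

end
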